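import Summits.QuantumFields.YangMills.Theorems.SwapVirialDeficitBlowUpGnomonicStratumBFlat
import Summits.QuantumFields.YangMills.Theorems.SwapVirialDeficitGnomonicTaylorTrChart
import Summits.QuantumFields.YangMills.Theorems.SwapVirialDeficitBlowUpChartDeficitZeroSet
import Summits.QuantumFields.YangMills.Theorems.SwapVirialDeficitSectorLaplaceDefs
import Summits.QuantumFields.YangMills.Theorems.SwapVirialDeficitOddSectorNoFlat
import HarnessLib

/-!
# THE FLAT VALLEY OF SECTOR 001 IN THE TRANSLATED CHART: at an END hub (`re a = 0`) the points `x = (0, t, −t·y₀)`, `y = (y₀, 0, 0)`, `z = 0`, `η_F = 0` are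
# EXACTLY FLAT — `trGnoDeficit uJ z₁ (sectorChar z₁) a ε η = 0` (sector-001 base point of LEAD sfw-p2 g98's memo7 plan of record for ⟨stmt-QuantumFields-24197⟩
# `SwapVirialDeficit.SwapGluedStiffness`, §E(5) ∕ board 19:28Z: `B₀₀₁ = {v ∈ S², m ∈ S¹ ⊥ v, s ∈ S¹}`, `C₂ = v`, `c = m`, `C₀ = exp(sv)`, `C₁ = C₀⁻¹`)

In the translated chart (✓`trGnomonicPoint uJ`, `C₂ = Q(j·ŷ)`) with the sector character `χ₁ = sectorChar z₁` (✓Defs §9; the `χ` of ✓`chartDeficit_twisted_eq_zero_iff`):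
at an end hub the hub unit is `A = ±i` (✓`end_hub_components`); for `y = (y₀,0,0)` the translated letter is `j·(±(1 + y₀ i)) = ±(j − y₀ k) =: v`, pure imaginary
and ⊥ `i`; for `x = (0, t, −t y₀)` the letter `x̂ = ±(1 + t(j − y₀k))` lies in `span{1, v}`, and the slaved letter is `Ā x̂ A = x̂*` (conjugation by `i` flips `j, k`).
Hence `C₀, C₁ = C₀⁻¹, C₂` commute pairwise, `c·C₁ = C₀·c`, `c·C₀ = C₁·c` (since `A v = −v A`) and `c·C₂ = (−1)·C₂·c` — the three clauses of
✓`chartDeficit_twisted_eq_zero_iff z₁` (centre values `1, 1, −1`), all followers being `1`: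
* §1 quaternion algebra: `comm_of_imI_zero_of_parallel`, `anticomm_of_end_hub`, `uJ_mul_components`, `star_mul_mul_end_hub`, `end_hub_intertwine`;
* §2 the four leaders of the translated point at an end hub (`su2Quat_trLeader_zero∕one∕two∕three_end`);
* §3 ★★★ `trGnoDeficit_001_flat_eq_zero (ha : a ≠ 0) (hre : a.re = 0) (hz : ε.2.1 = true) (hF : ε.2.2 = fun _ => true) (t y₀ : ℝ) :
  trGnoDeficit uJ z₁ (sectorChar z₁) a ε ((((0,t,−t y₀)), (y₀,0,0)), 0, 0) = 0`.
HONEST LABEL: the base-point identity of the 001 fibred Laplace lemma; its Hessian floors, the two 001 stubs, ⟨24197⟩ ∕ ⟨24194⟩ and every rung are OPEN; the Yang–Mills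
mass gap is NOT proved; no summit is proved by a line.  Seat ym-line-fcl-p3 g47 (cell ym-idea-1, free hands ➎ assembler; item of record ⟨24085⟩ aside, untouched),
`--supports stmt-QuantumFields-24197`.  THEOREMS ONLY (0 `def`, 0 `sorry`), standard axioms.  References: [cite: tHooft1979]; [cite: Luscher1983, §2]; [folklore].
-/

set_option autoImplicit false
set_option synthInstance.maxSize 1024

noncomputable section

open scoped BigOperators Quaternion
open Literature.MathematicalPhysics.QuantumFieldTheory hiding SU2
open Literature.MathematicalPhysics.QuantumLattice
open Literature.Analysis.Calculus (radialUnit radialUnit_def norm_radialUnit)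
open Literature.MathematicalPhysics.QuantumFieldTheory.Balaban1983to89.T4WilsonGaugeFlatDirection (su2Quat_injective)

namespace Summit.QuantumFields.YangMills.Theorems.SwapVirialDeficit.BlowUpRing

open Summit.QuantumFields.YangMills.Theorems.FemtoTransferGap
open Summit.QuantumFields.YangMills.Theorems.FemtoTransferGap.TT
open Summit.QuantumFields.YangMills.Theorems.VirialFluxGap.RingDeficit
open Summit.QuantumFields.YangMills.Theorems.SwapVirialDeficit.SwapRing
open Summit.QuantumFields.YangMills.Theorems.SwapVirialDeficit.SectorLaplace (z₁ uJ sectorChar sectorChar_eq uJ_ne_zero norm_uJ)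
open Summit.QuantumFields.YangMills.Theorems.SwapVirialDeficit.OddSectorNoFlat (su2Quat_negOne_mul)
open Summit.QuantumFields.YangMills.Theorems.SwapTwistDeficit.ToronLog (axisPoint)
open Summit.QuantumFields.YangMills.Theorems.SwapVirialDeficit.ZeroModeSigma (norm_axisUnit su2Quat_quatToSU2_eq_radialUnit)
open Summit.QuantumFields.YangMills.Theorems.SwapVirialDeficit.Gnomonic (su2Quat_trLeader_two trLeader_eq_of_ne_two trFollower_eq)

variable {L : ℕ} [NeZero L]

/-! ## §1 Quaternion algebra -/

omit [NeZero L] in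
/-- Two quaternions with vanishing `i`-components and parallel `(j,k)`-parts commute. [folklore] -/
theorem comm_of_imI_zero_of_parallel {p q : ℍ} (hp : p.imI = 0) (hq : q.imI = 0) (h : p.imJ * q.imK = p.imK * q.imJ) : p * q = q * p := by
  ext <;> simp [hp, hq] <;> nlinarith [h]

omit [NeZero L] in
/-- An end hub unit `A` (`re A = imJ A = imK A = 0`) ANTICOMMUTES with every pure-imaginary quaternion `⊥ i` (`re v = imI v = 0`). [folklore] -/
theorem anticomm_of_end_hub {A v : ℍ} (hA : A.re = 0 ∧ A.imJ = 0 ∧ A.imK = 0 ∧ A.imI ^ 2 = 1) (hv0 : v.re = 0) (hvI : v.imI = 0) : A * v = -(v * A) := by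
  obtain ⟨h0, hJ, hK, -⟩ := hA
  ext <;> simp [h0, hJ, hK, hv0, hvI] <;> ring

omit [NeZero L] in
/-- The components of `uJ·y` for an axial `y` (`imJ y = imK y = 0`): `j·(r + p i) = r j − p k`. [folklore] -/
theorem uJ_mul_components {y : ℍ} (hyJ : y.imJ = 0) (hyK : y.imK = 0) :
    (uJ * y).re = 0 ∧ (uJ * y).imI = 0 ∧ (uJ * y).imJ = y.re ∧ (uJ * y).imK = -y.imI := by
  refine ⟨?_, ?_, ?_, ?_⟩ <;> simp [uJ, hyJ, hyK]

omit [NeZero L] in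
/-- For an end hub unit `A` and `x` with `imI x = 0`: `Ā·x·A = x*`. [folklore] -/
theorem star_mul_mul_end_hub {A x : ℍ} (hA : A.re = 0 ∧ A.imJ = 0 ∧ A.imK = 0 ∧ A.imI ^ 2 = 1) (hxI : x.imI = 0) : star A * x * A = star x := by
  have hconj := conj_end_hub hA x
  ext
  · rw [hconj.1, Quaternion.re_star]
  · rw [hconj.2.1, Quaternion.imI_star, hxI, neg_zero]
  · rw [hconj.2.2.1, Quaternion.imJ_star]
  · rw [hconj.2.2.2, Quaternion.imK_star]


omit [NeZero L] in
/-- For an end hub unit `A` and `x` with `imI x = 0`: `A·x* = x·A` and `A·x = x*·A` (the pure part of `x` anticommutes with `A`). [folklore] -/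
theorem end_hub_intertwine {A x : ℍ} (hA : A.re = 0 ∧ A.imJ = 0 ∧ A.imK = 0 ∧ A.imI ^ 2 = 1) (hxI : x.imI = 0) :
    A * star x = x * A ∧ A * x = star x * A := by
  obtain ⟨h0, hJ, hK, -⟩ := hA
  constructor <;> ext <;> simp [h0, hJ, hK, hxI] <;> ring

/-! ## §2 The leaders of the translated point -/

omit [NeZero L] in
/-- `su2Quat` of the leaders `0, 1, 3` of the translated point are those of the master point; leader `2` is `uJ · radialUnit ŷ`. [folklore] -/
theorem su2Quat_trLeaders {a : ℍ} (ha : a ≠ 0) (ε : GnoSign L) (η : GnoCoord L) :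
    su2Quat ((blowUpPoint (L := L) 1 (trGnomonicPoint uJ a ε η)).1 0) = radialUnit (gnoLetter ε.1.1 η.1.1) ∧
    su2Quat ((blowUpPoint (L := L) 1 (trGnomonicPoint uJ a ε η)).1 1) =
      star (radialUnit (axisPoint a)) * radialUnit (gnoLetter ε.1.1 η.1.1) * radialUnit (axisPoint a) * radialUnit (gnoLetter ε.2.1 η.2.1) ∧
    su2Quat ((blowUpPoint (L := L) 1 (trGnomonicPoint uJ a ε η)).1 2) = uJ * radialUnit (gnoLetter ε.1.2 η.1.2) ∧
    su2Quat ((blowUpPoint (L := L) 1 (trGnomonicPoint uJ a ε η)).1 3) = radialUnit (axisPoint a) := by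
  refine ⟨?_, ?_, ?_, ?_⟩
  · rw [trLeader_eq_of_ne_two uJ a ε η (by decide)]; exact su2Quat_gnoLeader_zero a ε η
  · rw [trLeader_eq_of_ne_two uJ a ε η (by decide)]; exact su2Quat_gnoLeader_one ha ε η
  · rw [su2Quat_trLeader_two norm_uJ a ε η, su2Quat_gnoLeader_two]
  · rw [trLeader_eq_of_ne_two uJ a ε η (by decide)]; exact su2Quat_gnoLeader_three ha ε η

/-! ## §3 The flat valley of sector 001 -/

set_option maxHeartbeats 800000 in
/-- ★★★ **THE 001 FLAT VALLEY IN THE TRANSLATED CHART**: at an END hub (`a ≠ 0`, `re a = 0`), for sign patterns with the slaving letter and all followers on `+`,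
and every `t, y₀ : ℝ`,
`trGnoDeficit uJ z₁ (sectorChar z₁) a ε ((((0, t, −t·y₀)), (y₀, 0, 0)), 0, 0) = 0`
— the leaders `C₀ = Q(1 + t(j − y₀k))`, `C₁ = C₀⁻¹`, `C₂ = Q(j − y₀k)`, `c = ±i` commute ∕ intertwine exactly as ✓`chartDeficit_twisted_eq_zero_iff z₁` demands
(centre values `1, 1, −1`), and every follower is `1`. [cite: tHooft1979] [cite: Luscher1983, §2] -/
theorem trGnoDeficit_001_flat_eq_zero {a : ℍ} (ha : a ≠ 0) (hre : a.re = 0) (ε : GnoSign L) (hz : ε.2.1 = true) (hF : ε.2.2 = fun _ => true) (t y₀ : ℝ) :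
    trGnoDeficit uJ z₁ (sectorChar z₁) a ε
      ((((![0, t, -(t * y₀)] : Fin 3 → ℝ), (![y₀, 0, 0] : Fin 3 → ℝ)), ((0 : Fin 3 → ℝ), (0 : Fol L → Fin 3 → ℝ))) : GnoCoord L) = 0 := by
  set η₀ : GnoCoord L := ((((![0, t, -(t * y₀)] : Fin 3 → ℝ), (![y₀, 0, 0] : Fin 3 → ℝ)), ((0 : Fin 3 → ℝ), (0 : Fol L → Fin 3 → ℝ))) : GnoCoord L)
    with hη₀
  set q : (Fin 4 → SU2) × (Fol L → SU2) := blowUpPoint (L := L) 1 (trGnomonicPoint uJ a ε η₀) with hq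
  set A : ℍ := radialUnit (axisPoint a) with hA
  set xh : ℍ := radialUnit (gnoLetter ε.1.1 ![0, t, -(t * y₀)]) with hxh
  set yh : ℍ := radialUnit (gnoLetter ε.1.2 ![y₀, 0, 0]) with hyh
  have hAc := end_hub_components ha hre
  rw [← hA] at hAc
  have hA1 : ‖A‖ = 1 := norm_axisUnit ha
  -- the four leader quaternions
  obtain ⟨h0, h1, h2, h3⟩ := su2Quat_trLeaders (L := L) ha ε η₀
  rw [← hq] at h0 h1 h2 h3
  have h1' : su2Quat (q.1 1) = star xh := by
    rw [h1]
    show star A * xh * A * radialUnit (gnoLetter ε.2.1 (0 : Fin 3 → ℝ)) = star xh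
    rw [hz, gnoLetter_true_zero, radialUnit_one_quat, mul_one]
    have hxI : xh.imI = 0 := by
      rw [hxh, radialUnit_def, Quaternion.imI_smul, gnoLetter_eq]; simp [gnomonicQuat]
    exact star_mul_mul_end_hub hAc hxI
  have h0' : su2Quat (q.1 0) = xh := h0
  have h2' : su2Quat (q.1 2) = uJ * yh := h2
  have h3' : su2Quat (q.1 3) = A := h3
  -- components of the letters
  have hxI : xh.imI = 0 := by rw [hxh, radialUnit_def, Quaternion.imI_smul, gnoLetter_eq]; simp [gnomonicQuat]
  have hyJ : yh.imJ = 0 := by rw [hyh, radialUnit_def, Quaternion.imJ_smul, gnoLetter_eq]; simp [gnomonicQuat]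
  have hyK : yh.imK = 0 := by rw [hyh, radialUnit_def, Quaternion.imK_smul, gnoLetter_eq]; simp [gnomonicQuat]
  obtain ⟨hv0, hvI, hvJ, hvK⟩ := uJ_mul_components hyJ hyK
  -- `x̂` and `v = j·ŷ` have parallel `(j,k)`-parts: both `∝ (1, −y₀)`
  have hxJK : xh.imJ * (-(y₀)) = xh.imK * 1 := by
    rw [hxh, radialUnit_def, Quaternion.imJ_smul, Quaternion.imK_smul, gnoLetter_eq]; simp [gnomonicQuat]; ring
  have hyRI : yh.re * y₀ = yh.imI * 1 := by
    rw [hyh, radialUnit_def, Quaternion.re_smul, Quaternion.imI_smul, gnoLetter_eq]; simp [gnomonicQuat]; ring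
  have hpar : xh.imJ * (uJ * yh).imK = xh.imK * (uJ * yh).imJ := by
    rw [hvJ, hvK]
    -- xh.imJ * (-yh.imI) = xh.imK * yh.re, from xh.imK = -y₀ xh.imJ and yh.imI = y₀ yh.re
    have e1 : xh.imK = -(y₀ * xh.imJ) := by linarith
    have e2 : yh.imI = y₀ * yh.re := by linarith
    rw [e1, e2]; ring
  have hparS : (star xh).imJ * (uJ * yh).imK = (star xh).imK * (uJ * yh).imJ := by
    rw [Quaternion.imJ_star, Quaternion.imK_star, neg_mul, neg_mul, hpar]
  have hsI : (star xh).imI = 0 := by rw [Quaternion.imI_star, hxI, neg_zero]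
  -- unit facts
  have hx1 : ‖xh‖ = 1 := norm_radialUnit (gnoLetter_ne_zero _ _)
  have hxx : xh * star xh = 1 := by rw [Quaternion.self_mul_star, Quaternion.normSq_eq_norm_mul_self, hx1, mul_one, Quaternion.coe_one]
  have hxx' : star xh * xh = 1 := by rw [Quaternion.star_mul_self, Quaternion.normSq_eq_norm_mul_self, hx1, mul_one, Quaternion.coe_one]
  -- the commutation relations of the leaders `0, 1, 2` at the quaternion level
  have hc01 : su2Quat (q.1 0) * su2Quat (q.1 1) = su2Quat (q.1 1) * su2Quat (q.1 0) := by rw [h0', h1', hxx, hxx']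
  have hc02 : su2Quat (q.1 0) * su2Quat (q.1 2) = su2Quat (q.1 2) * su2Quat (q.1 0) := by
    rw [h0', h2']; exact comm_of_imI_zero_of_parallel hxI hvI hpar
  have hc12 : su2Quat (q.1 1) * su2Quat (q.1 2) = su2Quat (q.1 2) * su2Quat (q.1 1) := by
    rw [h1', h2']; exact comm_of_imI_zero_of_parallel hsI hvI hparS
  -- the σ-relations at the quaternion level (`A` intertwines `x̂` and `x̂*`; `A` anticommutes with `v`)
  have hAv : A * (uJ * yh) = -((uJ * yh) * A) := anticomm_of_end_hub hAc hv0 hvI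
  have hσ0 : su2Quat (q.1 3) * su2Quat (q.1 1) = su2Quat (q.1 0) * su2Quat (q.1 3) := by
    rw [h3', h1', h0']; exact (end_hub_intertwine hAc hxI).1
  have hσ1 : su2Quat (q.1 3) * su2Quat (q.1 0) = su2Quat (q.1 1) * su2Quat (q.1 3) := by
    rw [h3', h1', h0']; exact (end_hub_intertwine hAc hxI).2
  have hσ2 : su2Quat (q.1 3) * su2Quat (q.1 2) = -(su2Quat (q.1 2)) * su2Quat (q.1 3) := by
    rw [h3', h2', hAv, neg_mul]
  -- lift to `SU(2)`
  have lift : ∀ {U V U' V' : SU2}, su2Quat U * su2Quat V = su2Quat U' * su2Quat V' → U * V = U' * V' := fun h =>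
    su2Quat_injective (by rw [Balaban1983to89.T4HaarSU2Translate.su2Quat_mul, Balaban1983to89.T4HaarSU2Translate.su2Quat_mul]; exact h)
  unfold trGnoDeficit
  rw [← hq, sectorChar_eq, chartDeficit_twisted_eq_zero_iff]
  refine ⟨fun μ ν => ?_, fun μ => ?_, fun i => ?_⟩
  · fin_cases μ <;> fin_cases ν
    · rfl
    · exact lift hc01
    · exact lift hc02
    · exact lift hc01.symm
    · rfl
    · exact lift hc12
    · exact lift hc02.symm
    · exact lift hc12.symm
    · rfl
  · fin_cases μ
    · show q.1 (Fin.last 3) * q.1 (Fin.castSucc (Equiv.swap (0 : Fin 3) 1 0)) = centreElem (z₁ 0) * q.1 (Fin.castSucc 0) * q.1 (Fin.last 3)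
      rw [Equiv.swap_apply_left, show centreElem (z₁ 0) = 1 by rfl, one_mul]
      exact lift hσ0
    · show q.1 (Fin.last 3) * q.1 (Fin.castSucc (Equiv.swap (0 : Fin 3) 1 1)) = centreElem (z₁ 1) * q.1 (Fin.castSucc 1) * q.1 (Fin.last 3)
      rw [Equiv.swap_apply_right, show centreElem (z₁ 1) = 1 by rfl, one_mul]
      exact lift hσ1
    · show q.1 (Fin.last 3) * q.1 (Fin.castSucc (Equiv.swap (0 : Fin 3) 1 2)) = centreElem (z₁ 2) * q.1 (Fin.castSucc 2) * q.1 (Fin.last 3)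
      rw [Equiv.swap_apply_of_ne_of_ne (by decide) (by decide), show centreElem (z₁ 2) = negOne by rfl]
      refine su2Quat_injective ?_
      rw [Balaban1983to89.T4HaarSU2Translate.su2Quat_mul, Balaban1983to89.T4HaarSU2Translate.su2Quat_mul, su2Quat_negOne_mul]
      exact hσ2
  · rw [hq, trFollower_eq, gnoFollower_eq, hF]
    show quatToSU2 (gnoLetter true (0 : Fin 3 → ℝ)) = 1
    rw [gnoLetter_true_zero, quatToSU2_one_eq]

end Summit.QuantumFields.YangMills.Theorems.SwapVirialDeficit.BlowUpRing

end
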